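import Mathlib
import Literature.FieldTheory.AlgClosed.AutomorphismExtension
import Literature.LinearAlgebra.BaseChange.EigenvaluesRationalForm
import HarnessLib

/-!
# Baire uniformization on `Gal(ℚ̄/ℚ)`: a countable `Aut(ℂ)`-orbit of a germ forces one number field
(crux `HeckeEigenvalueField`, stmt-Langlands-13632, line `BaireSketch`; `--supports` file, theorems only)

* `exists_isOpen_of_countable_index` — in a compact Hausdorff group a countable-index subgroup
  covered by countably many closed subgroups has one of them open (Baire);
* `uniform_of_countable_autOrbit` — if the germ (modulo finite sets) of a countable family
  `a : ι → ℂ` has a countable orbit under `Aut(ℂ)`, and one automorphism moves all transcendental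
  entries off any countable subfield (hypothesis `hS3`, proved in `…StubS3`), then all but finitely
  many `a v` lie in ONE subfield of `ℂ` finite over `ℚ`.
Adapted from the crux-ideate sketch `Cruxes/HeckeEigenvalueField/BaireUniformExceptionalSetSketch.lean`.
-/

set_option linter.dupNamespace false

noncomputable section

open scoped Pointwise
open Filter

namespace Summit.Langlands.Langlands.Theorems.HeckeEigenvalueField.Baire

/-! ## S2 — the Baire lemma -/

/-- **Baire uniformization.** In a compact Hausdorff group, if a subgroup `H` of countable index is
covered by a countable family of CLOSED subgroups `K m`, then some `K m` is open. [folklore] -/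
theorem exists_isOpen_of_countable_index
    {G : Type*} [Group G] [TopologicalSpace G] [IsTopologicalGroup G] [CompactSpace G] [T2Space G]
    (K : ℕ → Subgroup G) (hK : ∀ m, IsClosed (K m : Set G)) (H : Subgroup G)
    (hcov : ∀ h ∈ H, ∃ m, h ∈ K m) [Countable (G ⧸ H)] :
    ∃ m, IsOpen (K m : Set G) := by
  classical
  let f : (G ⧸ H) × ℕ → Set G := fun p => p.1.out • (K p.2 : Set G)
  have hclosed : ∀ p, IsClosed (f p) := fun p => (hK p.2).smul _
  have hcover : ⋃ p, f p = Set.univ := by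
    refine Set.eq_univ_of_forall fun g => ?_
    have hmem : (QuotientGroup.mk g : G ⧸ H).out⁻¹ * g ∈ H := by
      rw [← QuotientGroup.eq, QuotientGroup.out_eq']
    obtain ⟨m, hm⟩ := hcov _ hmem
    refine Set.mem_iUnion.2 ⟨((QuotientGroup.mk g : G ⧸ H), m), ?_⟩
    refine Set.mem_smul_set.2 ⟨_, hm, ?_⟩
    simp [smul_eq_mul, mul_inv_cancel_left]
  obtain ⟨p, x, hx⟩ := nonempty_interior_of_iUnion_of_closed hclosed hcover
  refine ⟨p.2, (K p.2).isOpen_of_mem_nhds (g := p.1.out⁻¹ • x) ?_⟩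
  rw [← mem_interior_iff_mem_nhds]
  have hx' : x ∈ p.1.out • interior (K p.2 : Set G) := by
    rwa [← interior_smul]
  exact Set.mem_smul_set_iff_inv_smul_mem.1 hx'

/-! ## UNIF — countable `Aut(ℂ)`-orbit of a germ ⇒ one number field (proved from S3) -/

section UNIFProof

open Polynomial Cardinal


/-- Open subgroups of `Gal(ℚ̄/ℚ)` have number fields as fixed fields (Krull). [folklore] -/
theorem finiteDimensional_fixedField_of_isOpen_gal (H : Subgroup (AlgebraicClosure ℚ ≃ₐ[ℚ] AlgebraicClosure ℚ)) (hH : IsOpen (H : Set (AlgebraicClosure ℚ ≃ₐ[ℚ] AlgebraicClosure ℚ))) :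
    FiniteDimensional ℚ (IntermediateField.fixedField H) := by
  haveI : Algebra.IsAlgebraic ℚ (AlgebraicClosure ℚ) := AlgebraicClosure.isAlgebraic ℚ
  haveI : IsAlgClosure ℚ (AlgebraicClosure ℚ) := AlgebraicClosure.instIsAlgClosure ℚ
  haveI : IsGalois ℚ (AlgebraicClosure ℚ) := IsAlgClosure.isGalois ℚ _
  rw [← InfiniteGalois.isOpen_iff_finite]
  have h : (IntermediateField.fixedField H).fixingSubgroup = H :=
    InfiniteGalois.fixingSubgroup_fixedField ⟨H, H.isClosed_of_isOpen hH⟩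
  rw [h]
  exact hH

variable (jEmb : AlgebraicClosure ℚ →ₐ[ℚ] ℂ)

/-- Every algebraic complex number is in the image of `ℚ̄`. [folklore] -/
theorem exists_jEmb_eq {x : ℂ} (hx : IsAlgebraic ℚ x) : ∃ b : AlgebraicClosure ℚ, jEmb b = x := by
  have hint : IsIntegral ℚ x := hx.isIntegral
  set p : (AlgebraicClosure ℚ)[X] := (minpoly ℚ x).map (algebraMap ℚ (AlgebraicClosure ℚ)) with hp
  have hsplit : p.Splits := IsAlgClosed.splits p
  have hroots : p.roots.map jEmb.toRingHom = (p.map jEmb.toRingHom).roots :=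
    roots_map_of_injective_of_card_eq_natDegree jEmb.toRingHom.injective
      (splits_iff_card_roots.1 hsplit)
  have hmap : p.map jEmb.toRingHom = (minpoly ℚ x).map (algebraMap ℚ ℂ) := by
    rw [hp, Polynomial.map_map]
    congr 1
    exact jEmb.comp_algebraMap
  have hx0 : ((minpoly ℚ x).map (algebraMap ℚ ℂ)) ≠ 0 :=
    Polynomial.map_ne_zero (minpoly.ne_zero hint)
  have hxroot : x ∈ ((minpoly ℚ x).map (algebraMap ℚ ℂ)).roots := by
    rw [Polynomial.mem_roots hx0, IsRoot.def, eval_map, ← aeval_def, minpoly.aeval]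
  rw [← hmap, ← hroots, Multiset.mem_map] at hxroot
  obtain ⟨b, -, hb⟩ := hxroot
  exact ⟨b, hb⟩

/-- **Restriction `Aut(ℂ) → Gal(ℚ̄/ℚ)` is surjective** (homogeneity of `ℂ`,
`Literature.FieldTheory.AlgClosed.exists_ringEquiv_apply_eq`). [folklore] -/
theorem exists_aut_extending (τ : (AlgebraicClosure ℚ ≃ₐ[ℚ] AlgebraicClosure ℚ)) :
    ∃ σ : ℂ ≃ₐ[ℚ] ℂ, ∀ b, σ (jEmb b) = jEmb (τ b) := by
  haveI : Algebra.IsAlgebraic ℚ (AlgebraicClosure ℚ) := AlgebraicClosure.isAlgebraic ℚ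
  haveI : IsAlgClosure ℚ (AlgebraicClosure ℚ) := AlgebraicClosure.instIsAlgClosure ℚ
  haveI : IsGalois ℚ (AlgebraicClosure ℚ) := IsAlgClosure.isGalois ℚ _
  have hQ : #(AlgebraicClosure ℚ) ≤ ℵ₀ := by
    refine (Algebra.IsAlgebraic.cardinalMk_le_max ℚ (AlgebraicClosure ℚ)).trans ?_
    rw [Cardinal.mk_eq_aleph0 ℚ, max_self]
  have hC : ℵ₀ < #ℂ := by
    rw [Cardinal.mk_complex]
    exact Cardinal.aleph0_lt_continuum
  obtain ⟨σ, hσ⟩ := Literature.FieldTheory.AlgClosed.exists_ringEquiv_apply_eq hC hQ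
    jEmb.toRingHom (jEmb.toRingHom.comp τ.toAlgHom.toRingHom)
  refine ⟨AlgEquiv.ofRingEquiv (f := σ) fun q => ?_, fun b => hσ b⟩
  rw [Algebra.algebraMap_eq_smul_one, map_rat_smul, map_one]

end UNIFProof

section UNIF

open Polynomial Cardinal

/-- **(UNIF) from (S3).** If the germ (modulo finite sets) of a countable family `a : ι → ℂ` has a
COUNTABLE orbit under `Aut(ℂ)` — every conjugate family `σ ∘ a` agrees off a (σ-dependent) finite
set with a member of a fixed countable set `𝒞` — then all but finitely many `a v` lie in ONE subfield
of `ℂ` finite over `ℚ`: Baire category on `Gal(ℚ̄/ℚ)` uniformizes the exceptional sets. [folklore] -/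
theorem uniform_of_countable_autOrbit
    (hS3 : ∀ (M : Subfield ℂ), Cardinal.mk M ≤ Cardinal.aleph0 →
      ∀ (ι : Type) [Countable ι] (a : ι → ℂ),
        ∃ σ : ℂ ≃ₐ[ℚ] ℂ, ∀ v, Transcendental ℚ (a v) → σ (a v) ∉ M)
    {ι : Type} [Countable ι] (a : ι → ℂ) (𝒞 : Set (ι → ℂ)) (h𝒞 : 𝒞.Countable)
    (horbit : ∀ σ : ℂ ≃ₐ[ℚ] ℂ, ∃ c ∈ 𝒞, ∀ᶠ v in cofinite, σ (a v) = c v) :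
    ∃ E : Subfield ℂ, FiniteDimensional ℚ E ∧ ∀ᶠ v in cofinite, a v ∈ E := by
  classical
  haveI : Algebra.IsAlgebraic ℚ (AlgebraicClosure ℚ) := AlgebraicClosure.isAlgebraic ℚ
  haveI : IsAlgClosure ℚ (AlgebraicClosure ℚ) := AlgebraicClosure.instIsAlgClosure ℚ
  haveI : IsGalois ℚ (AlgebraicClosure ℚ) := IsAlgClosure.isGalois ℚ _
  let jEmb : AlgebraicClosure ℚ →ₐ[ℚ] ℂ := IsAlgClosed.lift
  -- Step 1: only finitely many entries are transcendental
  let V : Set ℂ := ⋃ c ∈ 𝒞, Set.range c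
  have hV : V.Countable := h𝒞.biUnion fun c _ => Set.countable_range c
  let M : Subfield ℂ := Subfield.closure V
  have hM : #M ≤ ℵ₀ := by
    refine (Subfield.cardinalMk_closure_le_max V).trans ?_
    exact max_le (Cardinal.le_aleph0_iff_set_countable.2 hV) le_rfl
  obtain ⟨σ₀, hσ₀⟩ := hS3 M hM ι a
  obtain ⟨c₀, hc₀, hc₀'⟩ := horbit σ₀
  have halg : ∀ᶠ v in cofinite, IsAlgebraic ℚ (a v) := by
    filter_upwards [hc₀'] with v hv
    by_contra htr
    apply hσ₀ v htr
    rw [hv]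
    exact Subfield.subset_closure (Set.mem_biUnion hc₀ ⟨v, rfl⟩)
  -- Step 2: algebraic entries come from `ℚ̄`
  have hpre : ∀ᶠ v in cofinite, ∃ b : AlgebraicClosure ℚ, jEmb b = a v := by
    filter_upwards [halg] with v hv using exists_jEmb_eq jEmb hv
  let b : ι → AlgebraicClosure ℚ := fun v =>
    if h : ∃ b : AlgebraicClosure ℚ, jEmb b = a v then h.choose else 0
  have hb : ∀ᶠ v in cofinite, jEmb (b v) = a v := by
    filter_upwards [hpre] with v hv
    simp only [b, dif_pos hv]
    exact hv.choose_spec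
  -- Step 3: pointwise stabilisers off finite sets (closed subgroups of `Gal(ℚ̄/ℚ)`)
  let Kst : Finset ι → Subgroup (AlgebraicClosure ℚ ≃ₐ[ℚ] AlgebraicClosure ℚ) := fun F =>
    ⨅ (v : ι) (_ : v ∉ F), MulAction.stabilizer (AlgebraicClosure ℚ ≃ₐ[ℚ] AlgebraicClosure ℚ) (b v)
  have hKst_mem : ∀ F (τ : (AlgebraicClosure ℚ ≃ₐ[ℚ] AlgebraicClosure ℚ)), τ ∈ Kst F ↔ ∀ v ∉ F, τ (b v) = b v := by
    intro F τ
    simp only [Kst, Subgroup.mem_iInf, MulAction.mem_stabilizer_iff, AlgEquiv.smul_def]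
  have hKst_closed : ∀ F, IsClosed (Kst F : Set (AlgebraicClosure ℚ ≃ₐ[ℚ] AlgebraicClosure ℚ)) := by
    intro F
    simp only [Kst, Subgroup.coe_iInf]
    refine isClosed_iInter fun v => isClosed_iInter fun _ => ?_
    apply Subgroup.isClosed_of_isOpen
    haveI : FiniteDimensional ℚ (IntermediateField.adjoin ℚ {b v}) :=
      IntermediateField.adjoin.finiteDimensional (Algebra.IsIntegral.isIntegral (b v))
    apply Subgroup.isOpen_mono (H₁ := (IntermediateField.adjoin ℚ {b v}).fixingSubgroup)
    · intro τ hτ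
      rw [MulAction.mem_stabilizer_iff, AlgEquiv.smul_def]
      exact (IntermediateField.mem_fixingSubgroup_iff _ _).1 hτ _
        (IntermediateField.mem_adjoin_simple_self ℚ (b v))
    · exact IntermediateField.fixingSubgroup_isOpen _
  -- the germ stabiliser
  let H : Subgroup (AlgebraicClosure ℚ ≃ₐ[ℚ] AlgebraicClosure ℚ) :=
    { carrier := {τ | ∀ᶠ v in cofinite, τ (b v) = b v}
      one_mem' := by
        change ∀ᶠ v in cofinite, _
        exact Filter.Eventually.of_forall fun _ => rfl
      mul_mem' := fun {σ τ} hσ hτ => by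
        change ∀ᶠ v in cofinite, _ at hσ hτ ⊢
        filter_upwards [hσ, hτ] with v h1 h2
        rw [AlgEquiv.mul_apply, h2, h1]
      inv_mem' := fun {σ} hσ => by
        change ∀ᶠ v in cofinite, _ at hσ ⊢
        filter_upwards [hσ] with v h1
        conv_lhs => rw [← h1]
        exact σ.symm_apply_apply _ }
  -- enumerate the finite subsets of `ι`; `H` is covered by the `Kst (e m)`
  obtain ⟨e, he⟩ := exists_surjective_nat (Finset ι)
  have hcov : ∀ τ ∈ H, ∃ m, τ ∈ Kst (e m) := by
    intro τ hτ
    have hτ' : ∀ᶠ v in cofinite, τ (b v) = b v := hτ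
    have hfin : {v | ¬ τ (b v) = b v}.Finite := Filter.eventually_cofinite.1 hτ'
    obtain ⟨m, hm⟩ := he hfin.toFinset
    refine ⟨m, (hKst_mem _ _).2 fun v hv => ?_⟩
    by_contra hne
    apply hv
    rw [hm, Set.Finite.mem_toFinset]
    exact hne
  -- Step 4: the index of `H` is countable (each coset is pinned by a member of `𝒞`)
  choose σ hσ using fun τ : (AlgebraicClosure ℚ ≃ₐ[ℚ] AlgebraicClosure ℚ) => exists_aut_extending jEmb τ
  choose c hc𝒞 hcτ using fun τ : (AlgebraicClosure ℚ ≃ₐ[ℚ] AlgebraicClosure ℚ) => horbit (σ τ)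
  have key : ∀ τ τ' : (AlgebraicClosure ℚ ≃ₐ[ℚ] AlgebraicClosure ℚ), c τ = c τ' →
      (QuotientGroup.mk τ : (AlgebraicClosure ℚ ≃ₐ[ℚ] AlgebraicClosure ℚ) ⧸ H) = QuotientGroup.mk τ' := by
    intro τ τ' h
    rw [QuotientGroup.eq]
    show ∀ᶠ v in cofinite, (τ⁻¹ * τ') (b v) = b v
    filter_upwards [hcτ τ, hcτ τ', hb] with v h1 h2 h3
    have h4 : jEmb (τ (b v)) = jEmb (τ' (b v)) := by
      rw [← hσ τ, ← hσ τ', h3, h1, h2, h]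
    have h5 : τ (b v) = τ' (b v) := jEmb.toRingHom.injective h4
    rw [AlgEquiv.mul_apply, ← h5]
    exact τ.symm_apply_apply _
  haveI : Countable 𝒞 := h𝒞.to_subtype
  haveI : Countable ((AlgebraicClosure ℚ ≃ₐ[ℚ] AlgebraicClosure ℚ) ⧸ H) := by
    let g : 𝒞 → (AlgebraicClosure ℚ ≃ₐ[ℚ] AlgebraicClosure ℚ) ⧸ H := fun s =>
      if h : ∃ τ, c τ = s.1 then QuotientGroup.mk h.choose else QuotientGroup.mk 1
    have hg : Function.Surjective g := by
      intro q
      induction q using QuotientGroup.induction_on with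
      | H τ =>
        refine ⟨⟨c τ, hc𝒞 τ⟩, ?_⟩
        have h : ∃ τ', c τ' = c τ := ⟨τ, rfl⟩
        simp only [g, dif_pos h]
        exact key _ _ h.choose_spec
    exact hg.countable
  -- Step 5: Baire
  obtain ⟨m, hm⟩ := exists_isOpen_of_countable_index (fun m => Kst (e m)) (fun m => hKst_closed _) H hcov
  haveI hfd : FiniteDimensional ℚ (IntermediateField.fixedField (Kst (e m))) :=
    finiteDimensional_fixedField_of_isOpen_gal (Kst (e m)) hm
  have hbE' : ∀ v ∉ e m, b v ∈ IntermediateField.fixedField (Kst (e m)) := by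
    intro v hv
    rw [IntermediateField.mem_fixedField_iff]
    intro τ hτ
    exact (hKst_mem _ _).1 hτ v hv
  set L : IntermediateField ℚ ℂ := (IntermediateField.fixedField (Kst (e m))).map jEmb with hL
  haveI : FiniteDimensional ℚ L :=
    LinearEquiv.finiteDimensional
      (IntermediateField.equivMap (IntermediateField.fixedField (Kst (e m))) jEmb).toLinearEquiv
  obtain ⟨E, hE, hiff⟩ := Literature.LinearAlgebra.BaseChange.exists_subfield_finiteDimensional_iff_mem L
  refine ⟨E, hE, ?_⟩
  have hfin : {v : ι | ¬ v ∉ e m}.Finite :=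
    (e m).finite_toSet.subset fun v (hv : ¬ v ∉ e m) => not_not.1 hv
  filter_upwards [hb, Filter.eventually_cofinite.2 hfin] with v h1 h2
  rw [hiff, ← h1, hL, IntermediateField.mem_map]
  exact ⟨b v, hbE' v h2, rfl⟩

end UNIF


end Summit.Langlands.Langlands.Theorems.HeckeEigenvalueField.Baire

end
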